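import Mathlib
import HarnessLib
import Summits.QuantumAdvantage.QuantumAdvantage.Theorems.DominoLawA

/-!
# The DOMINO LAW, part B: liveness on the domino cube and the slice law (lens 4 g26, node 4)

Part B.  §4 on a domino cube whose dominoes are all ACTIVE (`R_i ≢ 1 (mod 3)`) and whose middle cuts are all fired, the live count of
the fixed firing set `Y` is `L₀ + |o| (mod 2)` (`liveCountY_dom_mod_two`); §5 THE DOMINO SLICE LAW `domino_slice` (every field with
`2 ≠ 0`): `f` of degree `≤ D`, `Y` winning on `{f ≠ 0}`, `k ≥ 2D + 1` active fired dominoes ⇒ `f = 0` on the cube; corollary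
`levelSet_false_on_dominoCube` for perfect strategies (`p` odd, including `3`).  Supports stmt-QuantumAdvantage-28487 (record).
-/

set_option autoImplicit false
set_option linter.dupNamespace false

namespace Summit.QuantumAdvantage.QuantumAdvantage.Theorems.DominoLaw
open Classical
open Finset
open Summit.QuantumAdvantage.AdviceFreeQNC0
open Summit.QuantumAdvantage.AdviceFreeQNC0.JLinPeel
open Summit.QuantumAdvantage.QuantumAdvantage.Theorems.PhaseParity
open Summit.QuantumAdvantage.QuantumAdvantage.Theorems.GapLaw
open Literature.Computability.MetaComplexity Literature.Computability.MetaComplexity.Smolensky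

/-! ### §4 Liveness on the domino cube: one flip toggles one fired cut -/

section Parity

variable {n k : ℕ} (a : Fin k → ℕ) (hsep : ∀ i j : Fin k, i < j → a i + 2 ≤ a j) (hbd : ∀ i, a i + 2 ≤ n)

/-- The middle cut of domino `i`, as a cut of the board. -/
def midCut (i : Fin k) : Fin (n + 1) := ⟨a i + 1, by have := hbd i; omega⟩

/-- The live count as a sum of indicators. -/
theorem liveCountY_eq_sum (c : ℕ) (Y : Finset (Fin (n + 1))) (v : Fin n → Bool) :
    liveCountY c Y v = ∑ g ∈ Y, (if (c + g.val + walkExp v g.val) % 3 ≠ 0 then 1 else 0) := by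
  unfold liveCountY; rw [Finset.card_filter]

/-- Two consecutive residues, the first `≢ 1 (mod 3)`: exactly one of them is non-zero. -/
theorem ind_pair (R : ℕ) (hR : R % 3 ≠ 1) :
    (if R % 3 ≠ 0 then 1 else 0) + (if (R + 1) % 3 ≠ 0 then 1 else 0) = 1 := by
  by_cases h0 : R % 3 = 0
  · simp [h0, show (R + 1) % 3 ≠ 0 by omega]
  · simp [h0, show (R + 1) % 3 = 0 by omega]

/-- The same two residues in the other order. -/
theorem ind_pair' (R : ℕ) (hR : R % 3 ≠ 1) :
    (if (R + 1) % 3 ≠ 0 then 1 else 0) + (if R % 3 ≠ 0 then 1 else 0) = 1 := by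
  by_cases h0 : R % 3 = 0
  · simp [h0, show (R + 1) % 3 ≠ 0 by omega]
  · simp [h0, show (R + 1) % 3 = 0 by omega]

include hsep hbd in
/-- **One flip toggles one cut.**  If domino `i` is ACTIVE (`c + a_i + 1 + e_{a_i} ≢ 1 (mod 3)`) and its middle cut is fired,
changing its orientation changes the parity of the live count of `Y`. -/
theorem liveCountY_flip (c : ℕ) (Y : Finset (Fin (n + 1))) (u : Fin n → Bool) (o : Fin k → Bool) (i : Fin k)
    (b : Bool) (hb : b ≠ o i) (hY : midCut a hbd i ∈ Y)
    (hact : (c + a i + 1 + walkExp (dom a u o) (a i)) % 3 ≠ 1) :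
    (liveCountY c Y (dom a u o) + liveCountY c Y (dom a u (Function.update o i b))) % 2 = 1 := by
  rw [liveCountY_eq_sum, liveCountY_eq_sum, ← Finset.add_sum_erase Y _ hY, ← Finset.add_sum_erase Y _ hY]
  have hrest : ∑ g ∈ Y.erase (midCut a hbd i),
        (if (c + g.val + walkExp (dom a u (Function.update o i b)) g.val) % 3 ≠ 0 then 1 else 0) =
      ∑ g ∈ Y.erase (midCut a hbd i),
        (if (c + g.val + walkExp (dom a u o) g.val) % 3 ≠ 0 then 1 else 0) := by
    refine Finset.sum_congr rfl fun g hg => ?_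
    have hg' : g.val ≠ a i + 1 := fun h => (Finset.mem_erase.1 hg).1 (Fin.ext h)
    rw [walkExp_dom_update a hsep hbd u o i b hg']
  rw [hrest]
  have hm : (midCut a hbd i).val = a i + 1 := rfl
  rw [hm, walkExp_dom_mid a hsep hbd u o i b, walkExp_dom_mid_self a hsep hbd u o i]
  have hx : ((if o i = true then 1 else 0) = 0 ∧ (if b = true then 1 else 0) = 1) ∨
      ((if o i = true then 1 else 0) = 1 ∧ (if b = true then 1 else 0) = 0) := by
    cases hbb : b <;> cases hoo : o i <;> simp_all
  have e0 : c + (a i + 1) + (walkExp (dom a u o) (a i) + 0) = c + a i + 1 + walkExp (dom a u o) (a i) := by ring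
  have e1 : c + (a i + 1) + (walkExp (dom a u o) (a i) + 1) = c + a i + 1 + walkExp (dom a u o) (a i) + 1 := by ring
  have key : (if (c + (a i + 1) + (walkExp (dom a u o) (a i) + (if o i = true then 1 else 0))) % 3 ≠ 0 then 1 else 0) +
      (if (c + (a i + 1) + (walkExp (dom a u o) (a i) + (if b = true then 1 else 0))) % 3 ≠ 0 then 1 else 0) = 1 := by
    rcases hx with ⟨hx1, hx2⟩ | ⟨hx1, hx2⟩
    · rw [hx1, hx2, e0, e1]; exact ind_pair _ hact
    · rw [hx1, hx2, e0, e1]; exact ind_pair' _ hact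
  omega

include hsep hbd in
/-- **The live count on the domino cube is `L₀ + |o| (mod 2)`** when every domino is active and every middle cut fired. -/
theorem liveCountY_dom_mod_two (c : ℕ) (Y : Finset (Fin (n + 1))) (u : Fin n → Bool)
    (hY : ∀ i, midCut a hbd i ∈ Y) :
    ∀ (m : ℕ) (o : Fin k → Bool), wt o = m →
      (∀ i, (c + a i + 1 + walkExp (dom a u o) (a i)) % 3 ≠ 1) →
      (liveCountY c Y (dom a u o) + wt o) % 2 = liveCountY c Y (dom a u fun _ => false) % 2 := by
  intro m
  induction m with
  | zero =>
    intro o ho _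
    have hoo : o = fun _ => false := by
      funext i
      by_contra hne
      have hi : i ∈ (univ.filter fun i : Fin k => o i = true) :=
        Finset.mem_filter.2 ⟨mem_univ _, by cases h : o i <;> simp_all⟩
      unfold wt at ho
      rw [Finset.card_eq_zero.1 ho] at hi
      exact Finset.notMem_empty _ hi
    subst hoo
    rw [ho, add_zero]
  | succ m ih =>
    intro o ho hact
    obtain ⟨i, hi⟩ : (univ.filter fun i : Fin k => o i = true).Nonempty := by
      rw [← Finset.card_pos]; unfold wt at ho; rw [ho]; omega
    have hoi : o i = true := (Finset.mem_filter.1 hi).2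
    set o' := Function.update o i false with ho'
    have hwt : wt o' = m := by
      have hset : (univ.filter fun j : Fin k => o' j = true) = (univ.filter fun j : Fin k => o j = true).erase i := by
        ext j
        simp only [Finset.mem_filter, Finset.mem_univ, true_and, Finset.mem_erase, ho']
        by_cases hji : j = i
        · subst hji; simp
        · rw [Function.update_of_ne hji]; simp [hji]
      unfold wt; rw [hset, Finset.card_erase_of_mem hi]; unfold wt at ho; rw [ho]; rfl
    have hact' : ∀ j, (c + a j + 1 + walkExp (dom a u o') (a j)) % 3 ≠ 1 := by
      intro j
      rw [ho', walkExp_dom_update a hsep hbd u o i false (pos_succ_ne a hsep i j).symm]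
      exact hact j
    have h1 := ih o' hwt hact'
    have h2 := liveCountY_flip a hsep hbd c Y u o i false (by rw [hoi]; decide) (hY i) (hact i)
    rw [← ho'] at h2
    omega

end Parity

/-! ### §5 The domino slice law -/

section Law

variable {n k : ℕ}

/-- **THE DOMINO SLICE LAW.**  Over a field with `2 ≠ 0`: if `f` has degree `≤ D`, the fixed firing set `Y` wins at every
point of `{f ≠ 0}`, and the background `u` carries `k ≥ 2D + 1` disjoint dominoes (positions `a_i`, `a_j ≥ a_i + 2`) that are all
ACTIVE (`c + a_i + 1 + e_{a_i} ≢ 1 (mod 3)`) with fired middle cuts (`a_i + 1 ∈ Y`), then `f` vanishes on the whole domino cube. -/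
theorem domino_slice {F : Type*} [Field F] (h2 : (2 : F) ≠ 0) {D : ℕ} (hk : 2 * D + 1 ≤ k)
    (a : Fin k → ℕ) (hsep : ∀ i j : Fin k, i < j → a i + 2 ≤ a j) (hbd : ∀ i, a i + 2 ≤ n)
    (c : ℕ) (Y : Finset (Fin (n + 1))) (u : Fin n → Bool) (hY : ∀ i, midCut a hbd i ∈ Y)
    (hact : ∀ i, (c + a i + 1 + walkExp (dom a u fun _ => false) (a i)) % 3 ≠ 1)
    {f : CubeFn F n} (hf : f ∈ lowDeg F n D) (hwin : ∀ v, f v ≠ 0 → winY c Y v = true) :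
    ∀ o, f (dom a u o) = 0 := by
  set L₀ := liveCountY c Y (dom a u fun _ => false) with hL₀
  have hactall : ∀ (o : Fin k → Bool) (i : Fin k), (c + a i + 1 + walkExp (dom a u o) (a i)) % 3 ≠ 1 := by
    intro o i
    rw [walkExp_dom_indep a hsep hbd u (fun j => pos_succ_ne a hsep j i) _ o (fun _ => false) rfl]
    exact hact i
  have hpar : ∀ o : Fin k → Bool, (liveCountY c Y (dom a u o) + wt o) % 2 = L₀ % 2 := fun o =>
    liveCountY_dom_mod_two a hsep hbd c Y u hY (wt o) o rfl (hactall o)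
  have hzero := eq_zero_of_lowDeg_vanish_parity h2 L₀ hk (comp_dom_mem_lowDeg a hsep hbd u hf) (fun o ho => by
    by_contra hne
    have hw := hwin _ hne
    unfold winY at hw
    rw [decide_eq_true_eq] at hw
    have := hpar o
    omega)
  intro o
  exact congr_fun hzero o

/-- **Corollary (perfect feature level sets vanish on domino cubes).**  A perfect strategy firing the constant set `Y` on the
level set `{P = 1}` of `𝔽_p`-degree `≤ D` (`p` odd): `P = 0` on every cube of `2D + 1` active `Y`-dominoes. -/
theorem levelSet_false_on_dominoCube (p : ℕ) [Fact p.Prime] (hp2 : p ≠ 2) {D : ℕ} (hk : 2 * D + 1 ≤ k)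
    (a : Fin k → ℕ) (hsep : ∀ i j : Fin k, i < j → a i + 2 ≤ a j) (hbd : ∀ i, a i + 2 ≤ n)
    (c : ℕ) (y : Fin (n + 1) → (Fin n → Bool) → Bool) (P : (Fin n → Bool) → Bool) (hP : HasDegF p P D)
    (Y : Finset (Fin (n + 1))) (hfire : ∀ v, P v = true → ∀ g, (y g v = true ↔ g ∈ Y))
    (hperf : ∀ v, P v = true → ringWinU c y v = true) (u : Fin n → Bool) (hY : ∀ i, midCut a hbd i ∈ Y)
    (hact : ∀ i, (c + a i + 1 + walkExp (dom a u fun _ => false) (a i)) % 3 ≠ 1) :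
    ∀ o, P (dom a u o) = false := by
  have h2 : (2 : ZMod p) ≠ 0 := by
    intro h
    have h' : ((2 : ℕ) : ZMod p) = 0 := by exact_mod_cast h
    rw [ZMod.natCast_eq_zero_iff] at h'
    exact hp2 ((Nat.prime_dvd_prime_iff_eq (Fact.out) Nat.prime_two).1 h')
  have hwin : ∀ v, (fun x => if P x = true then (1 : ZMod p) else 0) v ≠ 0 → winY c Y v = true := by
    intro v hv
    have hPv : P v = true := by
      by_contra hc
      exact hv (by simp [hc])
    rw [← ringWinU_eq_winY c y Y v (hfire v hPv)]
    exact hperf v hPv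
  have hzero := domino_slice h2 hk a hsep hbd c Y u hY hact hP hwin
  intro o
  have h0 := hzero o
  by_contra hc
  rw [Bool.not_eq_false] at hc
  simp [hc] at h0

end Law

end Summit.QuantumAdvantage.QuantumAdvantage.Theorems.DominoLaw
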